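import Literature.AlgebraicGeometry.Frobenioids.CharacteristicSplitting
import HarnessLib

/-!
# Frobenioids I, Def. 2.3 (a) / Prop. 2.9 (ii): extending unit endomorphisms through the characteristic splitting — proofs (D-δ-2 groundwork)

Mochizuki, *The geometry of Frobenioids I*, Kyushu J. Math. **62** (2008), §2, proof of
Proposition 2.9 (ii), kurims p. 54 [cite: MochizukiFrdI2008, Prop. 2.9(ii) p.54]: "by applying the
characteristic splitting `O^×(C) × τ(C) ⥲ O^▷(C)`, we may write `β = β₀ · β₁` [where `β₀ ∈ O^×(C)`,
`β₁ ∈ τ(C)`]. Set `Ψ(β) := β₀^ζ · β₁`".  This file proves the algebraic step behind "set": any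
endomorphism `f` of the group `O^×(A)` extends uniquely, through the splitting, to an endomorphism
`Ψ_A` of the (commutative) monoid `O^▷(A)` fixing `τ(A)` pointwise.  PARTIAL: the functor `Ψ` of
Prop. 2.9 (ii) itself is not constructed here.  No new definitions (theorems only).
-/

namespace Literature.AlgebraicGeometry.Frobenioids

open CategoryTheory

universe w v v' u u'

namespace PreFrobenioid

namespace CharacteristicSplitting

variable {D : Type u} [Category.{v} D] {Φ : Dᵒᵖ ⥤ CommMonCat.{w}}
  {C : Type u'} [Category.{v'} C] {F : C ⥤ ElemFrobenioid Φ} (τ : CharacteristicSplitting F)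

/-- The splitting map `O^×(A) × τ(A) → O^▷(A)` is multiplicative (`O^▷(A)` is commutative,
Remark 1.3.1). [cite: MochizukiFrdI2008, Def. 2.3 p.47] -/
theorem splitMap_mul (hF : IsFrobenioid F) {A : C} (hA : IsIsotropic F A)
    (p q : unitsSubgroup F A × τ.τ A) :
    τ.splitMap hA (p * q) = τ.splitMap hA p * τ.splitMap hA q := by
  have hu : (⟨((p * q).1.1.hom : End A), (p * q).1.2⟩ : endSubmonoid F A) =
      ⟨(p.1.1.hom : End A), p.1.2⟩ * ⟨(q.1.1.hom : End A), q.1.2⟩ :=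
    Subtype.ext rfl
  have ht : (⟨(p * q).2.1, τ.τ_le hA (p * q).2.2⟩ : endSubmonoid F A) =
      ⟨p.2.1, τ.τ_le hA p.2.2⟩ * ⟨q.2.1, τ.τ_le hA q.2.2⟩ :=
    Subtype.ext rfl
  show (⟨((p * q).1.1.hom : End A), (p * q).1.2⟩ : endSubmonoid F A) *
      ⟨(p * q).2.1, τ.τ_le hA (p * q).2.2⟩ = _
  rw [hu, ht, mul_assoc, ← mul_assoc (⟨(q.1.1.hom : End A), q.1.2⟩ : endSubmonoid F A),
    endSubmonoid_comm F hF (⟨(q.1.1.hom : End A), q.1.2⟩ : endSubmonoid F A), mul_assoc, ← mul_assoc]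
  rfl

/-- The splitting map sends `(1, 1)` to `1`. [cite: MochizukiFrdI2008, Def. 2.3 p.47] -/
theorem splitMap_one {A : C} (hA : IsIsotropic F A) : τ.splitMap hA 1 = 1 :=
  Subtype.ext (one_mul (1 : End A))

/-- **"Set `Ψ(β) := β₀^ζ · β₁`"** ([FrdI] p. 54): every endomorphism `f` of the group `O^×(A)`
(e.g. raising to the `ζ`-th power) extends through the characteristic splitting to an endomorphism
`Ψ_A` of the monoid `O^▷(A)` with `Ψ_A(u · t) = f(u) · t` for `u ∈ O^×(A)`, `t ∈ τ(A)`.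
[cite: MochizukiFrdI2008, Prop. 2.9(ii) p.54] -/
theorem exists_endSubmonoid_extension (hF : IsFrobenioid F) {A : C} (hA : IsIsotropic F A)
    (f : unitsSubgroup F A →* unitsSubgroup F A) :
    ∃ Ψ : endSubmonoid F A →* endSubmonoid F A,
      ∀ (u : unitsSubgroup F A) (t : τ.τ A), Ψ (τ.splitMap hA (u, t)) = τ.splitMap hA (f u, t) := by
  classical
  let e : unitsSubgroup F A × τ.τ A ≃ endSubmonoid F A :=
    Equiv.ofBijective (τ.splitMap hA) (τ.splittingBijective hF hA)
  have he : ∀ p, e p = τ.splitMap hA p := fun _ => rfl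
  have hsymm : ∀ p, e.symm (τ.splitMap hA p) = p := fun p => by
    rw [← he]; exact e.symm_apply_apply p
  refine ⟨{ toFun := fun n => τ.splitMap hA (f (e.symm n).1, (e.symm n).2)
            map_one' := ?_, map_mul' := ?_ }, fun u t => by
    show τ.splitMap hA (f (e.symm (τ.splitMap hA (u, t))).1, (e.symm (τ.splitMap hA (u, t))).2) = _
    rw [hsymm]⟩
  · show τ.splitMap hA (f (e.symm 1).1, (e.symm 1).2) = 1
    have h1 : e.symm 1 = 1 := by rw [← τ.splitMap_one hA, hsymm]
    rw [h1, Prod.fst_one, Prod.snd_one, map_one]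
    exact τ.splitMap_one hA
  · intro m n
    show τ.splitMap hA (f (e.symm (m * n)).1, (e.symm (m * n)).2) =
      τ.splitMap hA (f (e.symm m).1, (e.symm m).2) * τ.splitMap hA (f (e.symm n).1, (e.symm n).2)
    have hmn : e.symm (m * n) = e.symm m * e.symm n := by
      apply e.injective
      rw [e.apply_symm_apply, he, τ.splitMap_mul hF hA, ← he, ← he, e.apply_symm_apply,
        e.apply_symm_apply]
    rw [hmn, Prod.fst_mul, Prod.snd_mul, map_mul, ← τ.splitMap_mul hF hA]
    rfl

/-- The extension is unique: an endomorphism of `O^▷(A)` is determined by its values on the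
`u · t`. [cite: MochizukiFrdI2008, Prop. 2.9(ii) p.54] -/
theorem endSubmonoid_extension_unique (hF : IsFrobenioid F) {A : C} (hA : IsIsotropic F A)
    {Ψ Ψ' : endSubmonoid F A →* endSubmonoid F A}
    (h : ∀ (u : unitsSubgroup F A) (t : τ.τ A), Ψ (τ.splitMap hA (u, t)) = Ψ' (τ.splitMap hA (u, t))) :
    Ψ = Ψ' := by
  ext n
  obtain ⟨⟨u, t⟩, rfl⟩ := τ.splitMap_surjective hF hA n
  exact congrArg Subtype.val (h u t)

end CharacteristicSplitting

end PreFrobenioid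

end Literature.AlgebraicGeometry.Frobenioids
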